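import Literature.NumberTheory.EllipticCurves.CyclotomicZpExtensionLayerTwoProofs
import Literature.NumberTheory.EllipticCurves.ZpExtensionUnitTwistProofs
import HarnessLib

/-!
# The first layer of the cyclotomic `ℤ₂`-extension of `ℚ` contains `√2` (`ℚ_1 = ℚ(√2) = ℚ(ζ₈)⁺`)
# — proofs only; no definitions, no named facts

Topic `NumberTheory/EllipticCurves` (sibling of `CyclotomicZpExtensionLayerTwoProofs.lean`, which
proves `ℚ_n ⊆ ℚ(μ_{2^{n+2}})`, i.e. `Gal(ℚ̄/ℚ(μ_{2^{n+2}})) ≤ Gal(ℚ̄/ℚ_n)`).  Seat `bsd-rank2-lit`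
(cell `bsd-rank2`, gen 15): the hypothesis `∃ θ : κ.layer 1, θ ^ 2 = 2` of
`Greenberg1999.thm19_selmerCorank_layer_le_lambdaInvariant.selmerCorank_add_selmerCorank_quadraticTwist_two_le`
(file `Greenberg1999/SelmerCorankLayerBound.lean`; consumer: the `bsd-rank2` planner's fact pack
`PublishedInputsAtTwo`, conjunct (d), door (F*) at `p = 2`) is discharged here for every cyclotomic
`κ : ZpExtension ℚ 2`.

## Statement and proof

* `CyclotomicZp.norm_sq_sub_one_le_of_two_dvd_ell` (the key `2`-adic estimate): for a unit `u`
  of `ℤ₂` with `2 ∣ ℓ(u)` (`ℓ` the normalised logarithm of `CyclotomicZpExtension.lean`,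
  `γ_cyc = 5`, `5^{2ℓ(u)} = u²`) one has `u² ≡ 1 (mod 16)`: `‖5^y − 1‖ = ‖y‖·‖4‖` (Serre, *Cours
  d'arithmétique* II.3.2, tree `PadicOneUnits.norm_oneAddPow_sub_one`) with `y = 2ℓ(u) ∈ 4ℤ₂`.
  Hence (`CyclotomicZp.toZModPow_three_of_two_dvd_ell`) `u ≡ ±1 (mod 8)` (the units of `ℤ/16`
  with square `1` are `±1, ±7`).
* `CyclotomicZp.smul_sqrtTwo_of_mem_layerSubgroup_one`: consequently every
  `σ ∈ Gal(ℚ̄/ℚ_1) = κ_cyc⁻¹(2ℤ₂)` acts on a primitive `8`-th root of unity `ζ` by `ζ ↦ ζ^{±1}`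
  (`GaloisRep.cyclotomicCharacter_spec`) and FIXES `ζ + ζ⁷ = ζ + ζ⁻¹`, whose square is `2`
  (`sq_add_pow_seven_eq_two`: `ζ⁴ = −1`).
* `ZpExtension.IsCyclotomic.exists_sq_eq_two_layer_one`: for EVERY cyclotomic `κ : ZpExtension ℚ 2`
  (a unit twist of `κ_cyc`, same layers) there is `θ ∈ ℚ_1 = κ.layer 1` with `θ² = 2`; with
  `[ℚ_1 : ℚ] = 2` (`finrank_layer_holds`) this is `ℚ_1 = ℚ(√2)`.

References: L. C. Washington, *Introduction to Cyclotomic Fields*, 2nd ed. (1997), §13.1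
(`ℚ_∞ ⊂ ℚ(μ_{2^∞})` is the fixed field of `{±1}`; `ℚ_1 = ℚ(√2)`) [Washington1997]; J.-P. Serre,
*A Course in Arithmetic*, Ch. II §3.2 Prop. 8 (`ℤ₂ˣ = {±1} × (1 + 4ℤ₂)`, `1 + 4ℤ₂ = 5^{ℤ₂}`) [Serre1973].

Design: proofs only; `noncomputable section`; file-local helpers `private`.
-/

noncomputable section

open scoped NumberField
open Field
open Literature.NumberTheory.GaloisRepresentations
open Literature.NumberTheory.EllipticCurves Literature.NumberTheory.EllipticCurves.PadicOneUnits

namespace Literature.NumberTheory.EllipticCurves.CyclotomicZp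

/-- At `p = 2` the cyclotomic exponent is `2` (`γ_cyc = 1 + 2² = 5`). [folklore] -/
private theorem cyclotomicExponent_two' : cyclotomicExponent 2 = 2 := by
  unfold cyclotomicExponent; simp

/-- At `p = 2` the torsion order `#μ(ℤ₂)` is `2`. [folklore] -/
private theorem torsionOrder_two' : torsionOrder 2 = 2 := by
  rw [torsionOrder, cyclotomicExponent_two']; decide

/-- **`2 ∣ ℓ(u) ⇒ u² ≡ 1 (mod 16)`** for a unit `u` of `ℤ₂`: with `y = 2ℓ(u) ∈ 4ℤ₂` and
`5^y = u²`, `‖u² − 1‖ = ‖5^y − 1‖ = ‖y‖·‖4‖ ≤ ‖16‖`.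
[cite: Serre1973, Ch. II §3.2 Prop. 8] -/
theorem norm_sq_sub_one_le_of_two_dvd_ell (u : ℤ_[2]ˣ) (h : (2 : ℤ_[2]) ∣ ell 2 u) :
    ‖(u : ℤ_[2]) ^ 2 - 1‖ ≤ ‖(2 : ℤ_[2]) ^ 4‖ := by
  set y : ℤ_[2] := torsionOrder 2 * ell 2 u with hy
  have h1 : cycPow 2 y = (u : ℤ_[2]) ^ torsionOrder 2 := cycPow_torsionOrder_mul_ell 2 u
  have h2 : ‖cycPow 2 y - 1‖ = ‖y‖ * ‖((2 : ℕ) : ℤ_[2]) ^ (cyclotomicExponent 2 - 1 + 1)‖ :=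
    norm_oneAddPow_sub_one (p := 2) (cyclotomicExponent 2 - 1) (cyclotomicExponent_cond 2) y
  rw [cyclotomicExponent_two', show (2 - 1 + 1 : ℕ) = 2 from rfl, Nat.cast_ofNat] at h2
  -- `‖y‖ ≤ ‖4‖`
  obtain ⟨x, hx⟩ := h
  have hy4 : y = (2 : ℤ_[2]) ^ 2 * x := by
    rw [hy, hx, torsionOrder_two', Nat.cast_ofNat]; ring
  have hny : ‖y‖ ≤ ‖(2 : ℤ_[2]) ^ 2‖ := by
    rw [hy4, norm_mul]
    exact mul_le_of_le_one_right (norm_nonneg ((2 : ℤ_[2]) ^ 2)) (PadicInt.norm_le_one x)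
  rw [torsionOrder_two'] at h1
  have hfin : ‖(u : ℤ_[2]) ^ 2 - 1‖ = ‖y‖ * ‖(2 : ℤ_[2]) ^ 2‖ := by rw [← h1, h2]
  calc ‖(u : ℤ_[2]) ^ 2 - 1‖ = ‖y‖ * ‖(2 : ℤ_[2]) ^ 2‖ := hfin
    _ ≤ ‖(2 : ℤ_[2]) ^ 2‖ * ‖(2 : ℤ_[2]) ^ 2‖ :=
        mul_le_mul_of_nonneg_right hny (norm_nonneg ((2 : ℤ_[2]) ^ 2))
    _ = ‖(2 : ℤ_[2]) ^ 4‖ := by rw [← norm_mul]; norm_num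

/-- The squares of `(ℤ/16)ˣ` equal to `1` come from `±1, ±7`: if `a² = 1` in `ℤ/16` then
`a mod 8 ∈ {1, 7}`. [folklore] -/
private theorem zmod16_sq_eq_one (a : ZMod (2 ^ 4)) (ha : a ^ 2 = 1) :
    (ZMod.castHom (pow_dvd_pow 2 (by norm_num : 3 ≤ 4)) (ZMod (2 ^ 3)) a).val = 1 ∨
      (ZMod.castHom (pow_dvd_pow 2 (by norm_num : 3 ≤ 4)) (ZMod (2 ^ 3)) a).val = 7 := by
  revert a
  decide

/-- **`2 ∣ ℓ(u) ⇒ u ≡ ±1 (mod 8)`**: the residue of `u` modulo `8` is `1` or `7`.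
[cite: Serre1973, Ch. II §3.2 Prop. 8] [cite: Washington1997, §13.1] -/
theorem toZModPow_three_of_two_dvd_ell (u : ℤ_[2]ˣ) (h : (2 : ℤ_[2]) ∣ ell 2 u) :
    (PadicInt.toZModPow 3 (u : ℤ_[2])).val = 1 ∨ (PadicInt.toZModPow 3 (u : ℤ_[2])).val = 7 := by
  have hn := norm_sq_sub_one_le_of_two_dvd_ell u h
  have hmem : (u : ℤ_[2]) ^ 2 - 1 ∈ (Ideal.span {((2 : ℕ) : ℤ_[2]) ^ 4} : Ideal ℤ_[2]) := by
    rw [← PadicInt.norm_le_pow_iff_mem_span_pow, ← PadicInt.norm_p_pow, Nat.cast_ofNat]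
    exact hn
  rw [← PadicInt.ker_toZModPow, RingHom.mem_ker, map_sub, map_pow, map_one, sub_eq_zero] at hmem
  have hcast : PadicInt.toZModPow 3 (u : ℤ_[2]) =
      ZMod.castHom (pow_dvd_pow 2 (by norm_num : 3 ≤ 4)) (ZMod (2 ^ 3))
        (PadicInt.toZModPow 4 (u : ℤ_[2])) := by
    rw [← PadicInt.zmod_cast_comp_toZModPow 3 4 (by norm_num)]
    rfl
  rw [hcast]
  exact zmod16_sq_eq_one _ hmem

/-- For a primitive `8`-th root of unity `ζ`: `ζ⁴ = −1`. [folklore] -/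
private theorem pow_four_eq_neg_one {F : Type*} [Field F] {ζ : F} (hζ : IsPrimitiveRoot ζ (2 ^ 3)) :
    ζ ^ 4 = -1 := by
  have h8 : ζ ^ 8 = 1 := by simpa using hζ.pow_eq_one
  have h4 : ζ ^ 4 ≠ 1 := hζ.pow_ne_one_of_pos_of_lt (by norm_num) (by norm_num)
  have hsq : ζ ^ 4 * ζ ^ 4 = 1 := by rw [← pow_add]; exact h8
  rcases mul_self_eq_one_iff.mp hsq with h | h
  · exact (h4 h).elim
  · exact h

/-- **`(ζ + ζ⁷)² = 2`** for a primitive `8`-th root of unity `ζ` (`ζ⁷ = ζ⁻¹`, `ζ² + ζ⁻² = 0`):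
`√2 = ζ₈ + ζ₈⁻¹ ∈ ℚ(ζ₈)`. [cite: Washington1997, §13.1] -/
theorem sq_add_pow_seven_eq_two {F : Type*} [Field F] {ζ : F} (hζ : IsPrimitiveRoot ζ (2 ^ 3)) :
    (ζ + ζ ^ 7) ^ 2 = 2 := by
  have h8 : ζ ^ 8 = 1 := by simpa using hζ.pow_eq_one
  have h4 : ζ ^ 4 = -1 := pow_four_eq_neg_one hζ
  have e : (ζ + ζ ^ 7) ^ 2 = ζ ^ 2 + 2 * ζ ^ 8 + ζ ^ 8 * (ζ ^ 4 * ζ ^ 2) := by ring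
  rw [e, h8, h4]; ring

/-- A Galois automorphism with `χ₂(σ) ≡ ±1 (mod 8)` fixes `ζ + ζ⁷` (`ζ` a primitive `8`-th root of
unity): `σ ζ = ζ^{±1}`. [cite: Washington1997, §13.1] -/
private theorem smul_add_pow_seven_eq {σ : absoluteGaloisGroup ℚ} {ζ : AlgebraicClosure ℚ}
    (hζ : IsPrimitiveRoot ζ (2 ^ 3))
    (hv : (PadicInt.toZModPow 3 ((GaloisRep.cyclotomicCharacter ℚ 2 σ : ℤ_[2]ˣ) : ℤ_[2])).val = 1 ∨
      (PadicInt.toZModPow 3 ((GaloisRep.cyclotomicCharacter ℚ 2 σ : ℤ_[2]ˣ) : ℤ_[2])).val = 7) :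
    σ • (ζ + ζ ^ 7) = ζ + ζ ^ 7 := by
  have h8 : ζ ^ 8 = 1 := by simpa using hζ.pow_eq_one
  have hspec := GaloisRep.cyclotomicCharacter_spec ℚ 2 (k := 3) σ ζ hζ.pow_eq_one
  rw [smul_add, smul_pow', hspec]
  rcases hv with hv | hv
  · rw [hv, pow_one]
  · rw [hv, ← pow_mul, show (7 * 7 : ℕ) = 8 * 6 + 1 by norm_num, pow_add, pow_mul, h8, one_pow,
      one_mul, pow_one, add_comm]

/-- **Every `σ ∈ Gal(ℚ̄/ℚ_1) = κ_cyc⁻¹(2ℤ₂)` fixes `ζ₈ + ζ₈⁻¹`** (the normalised cyclotomic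
`ℤ₂`-extension `κ_cyc = ℓ ∘ χ₂`: `2 ∣ ℓ(χ₂ σ)` forces `χ₂(σ) ≡ ±1 (mod 8)`).
[cite: Washington1997, §13.1] -/
theorem smul_sqrtTwo_of_mem_layerSubgroup_one {σ : absoluteGaloisGroup ℚ}
    (hσ : σ ∈ (zpExtension 2).layerSubgroup 1) {ζ : AlgebraicClosure ℚ}
    (hζ : IsPrimitiveRoot ζ (2 ^ 3)) : σ • (ζ + ζ ^ 7) = ζ + ζ ^ 7 := by
  rw [ZpExtension.mem_layerSubgroup, zpExtension_apply, toAdd_ofAdd, pow_one] at hσ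
  exact smul_add_pow_seven_eq hζ (toZModPow_three_of_two_dvd_ell _ hσ)

/-- **`√2 ∈ ℚ_1` for the normalised cyclotomic `ℤ₂`-extension**: the first layer
`ℚ_1 = ℚ̄^{κ_cyc⁻¹(2ℤ₂)}` contains an element of `ℚ̄` with square `2` (namely `ζ₈ + ζ₈⁻¹`).
[cite: Washington1997, §13.1] -/
theorem exists_mem_layer_one_sq_eq_two_zpExtension :
    ∃ t : AlgebraicClosure ℚ, t ∈ (zpExtension 2).layer 1 ∧ t ^ 2 = 2 := by
  haveI : NeZero (2 ^ 3 : ℕ) := ⟨by norm_num⟩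
  obtain ⟨ζ, hζ⟩ := HasEnoughRootsOfUnity.exists_primitiveRoot (AlgebraicClosure ℚ) (2 ^ 3)
  have hmem : ζ + ζ ^ 7 ∈ (zpExtension 2).layer 1 := by
    change ζ + ζ ^ 7 ∈ IntermediateField.fixedField _
    rw [IntermediateField.mem_fixedField_iff]
    rintro _ ⟨σ, hσ, rfl⟩
    exact smul_sqrtTwo_of_mem_layerSubgroup_one hσ hζ
  exact ⟨ζ + ζ ^ 7, hmem, sq_add_pow_seven_eq_two hζ⟩

/-- The same as an element of the layer: `∃ θ : ℚ_1, θ² = 2` for `κ_cyc`. [cite: Washington1997, §13.1] -/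
theorem exists_sq_eq_two_layer_one_zpExtension :
    ∃ θ : (zpExtension 2).layer 1, θ ^ 2 = 2 := by
  obtain ⟨t, ht, ht2⟩ := exists_mem_layer_one_sq_eq_two_zpExtension
  refine ⟨⟨t, ht⟩, Subtype.ext ?_⟩
  change t ^ 2 = (2 : AlgebraicClosure ℚ)
  exact ht2

end Literature.NumberTheory.EllipticCurves.CyclotomicZp

namespace Literature.NumberTheory.EllipticCurves.ZpExtension

/-- **`√2 ∈ ℚ_1` for EVERY cyclotomic `ℤ₂`-extension `κ` of `ℚ`** (`κ` is a unit twist of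
`κ_cyc`, and unit twists do not move the layers): the first layer `ℚ_1 = κ.layer 1` (a quadratic
field, `finrank_layer_holds`) contains an element of square `2`, i.e. `ℚ_1 = ℚ(√2) = ℚ(ζ₈)⁺`.  This
is the hypothesis `hsqrt` of
`Greenberg1999.thm19_selmerCorank_layer_le_lambdaInvariant.selmerCorank_add_selmerCorank_quadraticTwist_two_le`.
[cite: Washington1997, §13.1] -/
theorem IsCyclotomic.exists_sq_eq_two_layer_one {κ : ZpExtension ℚ 2} (hκ : κ.IsCyclotomic) :
    ∃ θ : κ.layer 1, θ ^ 2 = 2 := by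
  obtain ⟨u, rfl⟩ := IsCyclotomic.exists_eq_unitTwist_holds
    (CyclotomicZp.isCyclotomic_zpExtension 2) hκ
  have hlayer : ((CyclotomicZp.zpExtension 2).unitTwist u).layer 1 =
      (CyclotomicZp.zpExtension 2).layer 1 := by
    unfold ZpExtension.layer
    rw [layerSubgroup_unitTwist]
  obtain ⟨t, ht, ht2⟩ := CyclotomicZp.exists_mem_layer_one_sq_eq_two_zpExtension
  have ht' : t ∈ ((CyclotomicZp.zpExtension 2).unitTwist u).layer 1 := by
    rw [hlayer]; exact ht
  refine ⟨⟨t, ht'⟩, Subtype.ext ?_⟩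
  change t ^ 2 = (2 : AlgebraicClosure ℚ)
  exact ht2

end Literature.NumberTheory.EllipticCurves.ZpExtension

end
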